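import Summits.SmoothPoincare4.SmoothPoincare4.Theorems.ConvexBisectionAcyclicBisectionExistsDualLinkNodes
import Summits.SmoothPoincare4.SmoothPoincare4.Theorems.ConvexBisectionAcyclicBisectionExistsBeltBasePush
import Summits.SmoothPoincare4.SmoothPoincare4.Theorems.ConvexBisectionAcyclicBisectionExistsBeltPageClause
import Summits.SmoothPoincare4.SmoothPoincare4.Theorems.ConvexBisectionAcyclicBisectionExistsPageInvariance
import Summits.SmoothPoincare4.SmoothPoincare4.Theorems.ConvexBisectionAcyclicBisectionExistsPageInvarianceTwisting
import Summits.SmoothPoincare4.SmoothPoincare4.Theorems.ConvexBisectionAcyclicBisectionExistsCrossingNumberGenerators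
import Summits.SmoothPoincare4.SmoothPoincare4.Theorems.ConvexBisectionAcyclicBisectionExistsSeamStraightenFlow
import Summits.SmoothPoincare4.SmoothPoincare4.Theorems.ConvexBisectionAcyclicBisectionExistsSeamExtendedPage
import Summits.SmoothPoincare4.SmoothPoincare4.Theorems.ConvexBisectionAcyclicBisectionExistsSeamShadowTransport
import Summits.SmoothPoincare4.SmoothPoincare4.Theorems.ConvexBisectionAcyclicBisectionExistsSeamTransportAssembly
import Literature.Geometry.Symplectic.TwoHandleIsotopyFraming
import HarnessLib

/-!
# DESIGN SKELETON — NF6 node T3c-2 `node_seam_transport`: the page clause of a fibred model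
# transports framed page knots through the seam diffeomorphism
(design file of brief Y3, wave 4, lead c5; crux `ConvexBisection.AcyclicBisectionExists`, item
stmt-SmoothPoincare4-10508, line `modp-braid-orbits` r11, parent stub `stub_steinRealisation` (NF6)
▸ node T3 (`work/design/T3_DualHandles_Design.lean` §2) ▸ T3c-2).
`lean check`: rc 0; `sorry` ONLY in the theorem `node_ST4_twistSign` (ST1 is LANDED:
`helper_seam_extendedPage`; ST2 is LANDED: `helper_strField_spec`, `helper_strFlow_page` =
`node_ST2_straightening` below; ST3 is LANDED/PROPOSED: `helper_seam_fibreMap`,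
`helper_seam_shadowLinear`, `helper_seam_shadowEquiv`, `helper_seam_shadowTransport` =
`node_ST3_shadowTransport`; proposal ids in `work/stubs/Y3-REPORT.md`).  The node text
`node_seam_transport` (T3 design l. 544–575, consumed VERBATIM by Z7's landed contract
`node_dualLink_pageLink_of_universal_nodes`, file `…DualLinkNodes.lean`) is ASSEMBLED SORRY-FREE in §2
from the four sub-nodes, and the same assembly is LANDED as the contract
`node_seam_transport_of_twistSign` (`…SeamTransportAssembly.lean`, ST4 taken as a hypothesis at the
data): the lead's `node_seam_transport g l h hlink D bX Ψ hpage` is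
`node_seam_transport_of_twistSign D bX Ψ hlink hpage (node_ST4_twistSign g l h hlink D bX Ψ hpage)`.
This file is evidence, not a Theorems file.

## The setting and the one-line proof

Data of a fibred model: `X = Base g ∪_{h̄} (handles)` along a Lefschetz link `h` of word `l` (data
`D`), a boundary datum `bX` of `X`, the seam `Ψ : bX.carrier ≅ ∂ Base g`, and the PAGE CLAUSE
`w (Ψ y) = c(y) · w (a)`, `c(y) > 0`, whenever `bX.incl y = D.jA a` (`PageClause`).  Write
`G := (bBase g).incl ∘ Ψ : bX.carrier → Base g` (a smooth embedding onto `∂ Base g`) and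
`U := (bX.incl)⁻¹ (range D.jA) ⊆ bX.carrier`; by invariance of domain for the open embedding `jA`,
EVERY point of `∂ Base g` off the cores `Kⱼ = (h j).attachingCircle` lifts to `U`, so the node's
hypothesis `bX.incl (z θ) = D.jA ⟨K θ, _⟩` is available for every page knot off the cores.  The map
`F := G ∘ (lift) : ∂ Base g ∖ ⋃ Kⱼ → ∂ Base g` is a DIFFEOMORPHISM ONTO `∂ Base g ∖ ⋃ βⱼ`, `βⱼ := G`(belt
circle of handle `j`) = the dual attaching circles (the deep belt points are the only points of `∂X`
not in `range jA`: `BeltPageClause.lamSq_eq_zero_of_not_mem_range_jA`), and it preserves the page angle: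
`w ∘ F ∈ ℝ_{>0} · w`.  Hence, with `E_c := {rho = 1/4, w ∈ ℝ_{>0} c}` the EXTENDED PAGE (flat part
`page g c = E_c ∩ {‖x‖² < 4}`, bent part `‖x‖² ≥ 4` going down to the binding `w = 0`):
`F (page g c ∖ cores) ⊆ E_c`, and `βⱼ ⊆ E_{pageDir j}` (`helper_belt_pageClause`, V4: `c > 0` at the
belt circles).  So for a NON-CRITICAL direction `c ∉ {pageDir |l| j}` the fibre map
`F_c : E_c → E_c` is a HOMEOMORPHISM of the extended page (bijective: `F` is a bijection
`∂B ∖ cores → ∂B ∖ β` preserving angles in both directions, and `E_c` meets neither the cores nor `β`).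

* (ST1) the pushed framed knot `(G ∘ z, dG(u))` is a framed knot in `∂ Base g`, inside `E_c`, with
  `‖w‖ ≥ m > 0` (compactness);
* (ST2) the RADIAL STRAIGHTENING isotopy `S_t` of `Base g` (LANDED): `rho`, the direction of `w`
  invariant, `‖w‖` non-decreasing, and `S_1 (E_c ∩ {‖w‖ ≥ m}) ⊆ page g c`; so
  `K' := S_1 ∘ G ∘ z ⊆ page g c`, `ν' := dS_1 (dG u)`, and `t ↦ S_t ∘ G ∘ z` is a link isotopy in
  `∂ Base g` (components at distinct directions stay in their own `E_{c i}`; an ambient isotopy is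
  injective at each time anyway) carrying `dG(u)` to `ν'` (`IsKnotFraming.pushforward`,
  `continuous_mfderiv_ambientIsotopy_bundle`); shadows are unchanged (`shadow_comp_ambientIsotopy`);
* (ST3) `shadow (G ∘ z) = A_c (shadow K)` for ONE automorphism `A_c` of `ℤ^{2g}` depending on
  `(Ψ, c)` only: for non-critical `c`, `A_c := e ∘ (F_c)_* ∘ e⁻¹` read through
  `e : H₁(page g c) ≅ H₁(Base g) ≅ ℤ^{2g}` (`bijective_shadowMap_map_pageIncl`, Z6-2) — well defined and
  linear because page loops with equal shadows are homologous IN THE PAGE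
  (`loopClass_page_eq_of_shadow_eq`), BIJECTIVE because the inverse fibre map `F_c⁻¹` gives the inverse
  matrix once `F_c`-images are straightened back into the flat page INSIDE `E_c ∖ β = E_c` (ST2) —;
  for a CRITICAL `c = pageDir j₀`, rotate the knot off the critical page by the rigid page rotation
  `helper_rotFlow_page` through pages `c e^{it}`, `0 < t ≤ ε`, which contain no core (finitely many
  critical directions, `pageDir_injOn`), staying off the cores at `t = 0` by hypothesis: `F ∘ R_t ∘ K`
  is a homotopy in `Base g`, so `A_c := A_{c e^{iε}}` works for EVERY knot of `page g c ∖ K_{j₀}`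
  (the two neighbours `A_{c e^{±iε}}` differ by the Picard–Lefschetz transvection of `K_{j₀}`, which
  fixes the classes of loops disjoint from `K_{j₀}` — consistent);
* (ST4) `pageTwisting (S_1 ∘ G ∘ z) (dS_1 dG u) = s₀ · pageTwisting K ν` with `s₀ = ±1` the
  ORIENTATION CHARACTER of `F` on `∂ Base g` (GLOBAL: `F` is angle-preserving, so its co-orientation
  character is `+1` and its orientation character equals its page-orientation character; it is locally
  constant on `∂B ∖ cores`, which is connected — proof WITHOUT general position: each open sector
  `arg w ∈ (pageDir (j+1), pageDir j)` of `∂B ∖ binding` is connected (straighten into the flat sector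
  `≅ page × interval`, `pathConnectedSpace_page_of_norm` + `helper_rotFlow_page`), consecutive sectors
  both meet a small ball around any point of the critical extended page off the core, and every point
  of `∂B ∖ cores` has such a ball meeting a sector (`w|∂B` is open at binding points,
  `BeltPageClause.frequently_neg_ray`)).  POINTWISE it is V3's computation
  (`pageTwistingLoop_baseReflection_pointwise`) for an arbitrary page-preserving local diffeomorphism
  `Γ = S_1 ∘ F` between FLAT page neighbourhoods: `ℓ̃₂ = p(t) ℓ₂` with `p > 0`
  (`⟪V, n⟫ = ‖n‖² d(arg w)(V)` and `Γ` preserves `arg w`) and, where `ℓ₂ = 0`, `ℓ̃₁ = det(dΓ|T page) ℓ₁`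
  (the framing is then tangent to the complex line `T page`, on which `⟪LV, iLT⟫ = det L · ⟪V, iT⟫`);
  the straight-line homotopy to `(s₀ Re ℓ, Im ℓ)` does not vanish (`helper_pageTwistingLoop_ne_zero`),
  so `wind ℓ̃ = s₀ wind ℓ` (`wind_eq_of_homotopy`, `wind_conj`, `wind_neg`).

## VERDICT ON THE NODE TEXT (for the lead; details in `work/stubs/Y3-REPORT.md`)

TRUE AS STATED, including `A i : ℤ^{2g} ≃ₗ[ℤ] ℤ^{2g}` (a genuine automorphism, no weakening to an
injective map is needed or helpful: injectivity of `A` costs exactly as much as bijectivity, both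
need the inverse fibre map and ST2) and including CRITICAL directions `c i = pageDir |l| j` (by the
rotation trick of ST3; Z7 only ever applies the node at the non-critical directions
`pageDir (m+n) (m+j) e^{-iη}`, `0 < η < 2π/(m+n)`).  Two remarks.  (a) In the node `A` is quantified
AFTER the knots, so it may depend on `K i`; ST3 delivers the stronger uniform `A_{c}`.  (b) The node's
`∃ A` with `A` depending on the knot would be equivalent to `content (shadow K') = content (shadow K)`;
the uniform version is the honest fibre-transport statement.  No repair of Z7's contract is proposed.

## Sub-node DAG and sizes (≈ 2400–2600 lines in all; 1690 landed/proposed by Y3, ST4 remains)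

  ST2 (LANDED, 576 lines: `…SeamStraightenField.lean` 292 + `…SeamStraightenFlow.lean` 284)
   │
   ├──> ST1 (LANDED, 186 lines, `…SeamExtendedPage.lean`: Z7's `helper_isKnotFraming_seamPush` +
   │         `mfderiv_seamDiffeo` + uniqueness of the lifts `z`, `u` through the embedding `bX.incl`)
   ├──> ST3 (LANDED/PROPOSED, 928 lines: ST3-core `…SeamFibreMap.lean` 303 (the seam map `F` and
   │         `F⁻¹` on `∂B`), ST3a `…SeamShadowLinear.lean` 156 (linearity by naturality), ST3b
   │         `…SeamShadowInverse.lean` 288 (bijectivity via `F⁻¹` + ST2), ST3(c) `…SeamShadowTransport.lean`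
   │         191 (critical directions by a small page rotation; the sub-node itself))
   ├──> ST4 (L, ≈ 600–800 REMAINING: (4a) pointwise algebra ≈ 250 (V3's files are the template) + the
   │         winding step (4a-wind) LANDED (`helper_wind_upperTriangular`, `…SeamTwistSignWind.lean`, 133);
   │         (4b) orientation character of `F`: definition through `ambient`/`fderiv_rho_ambient`, local
   │         constancy ≈ 250; (4c) sector connectedness and globalisation ≈ 200)
   └──> ST5 (PROVED below and LANDED as `node_seam_transport_of_twistSign`, `…SeamTransportAssembly.lean`
             279 lines): the node text verbatim from ST4.

References: R. İ. Baykur, *Kähler decomposition of 4-manifolds*, AGT 6 (2006), proof of Thm. 5.1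
[Baykur2006]; J. B. Etnyre, T. Fuller, IMRN 2006, Thm. 1 (proof, p. 8) [EtnyreFuller2006];
R. E. Gompf, A. I. Stipsicz, *4-Manifolds and Kirby Calculus* (1999), §8.2 [GompfStipsicz1999];
A. Kosinski, *Differential Manifolds* (1993), VI §6 [Kosinski1993].
-/

noncomputable section

set_option linter.dupNamespace false
set_option linter.unusedVariables false

open scoped Manifold ContDiff Topology

namespace Summit.SmoothPoincare4.SmoothPoincare4.Theorems.AcyclicBisectionExists.ModpBraidOrbits

open Set Function Filter Metric Topology Bundle
open Literature.Topology.FourManifolds Literature.Topology.FourManifolds.HandleAttachingMap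
  Literature.Topology.FourManifolds.BoundaryManifold Literature.Topology.FourManifolds.LefschetzBase
  Literature.Geometry.Symplectic

/-! ## §0 Plumbing — LANDED in `…SeamTransportAssembly.lean` (p152668) and imported from there:
`knotIsotopyOfAmbient` (a `rho`-preserving ambient isotopy of `Base g` moves a boundary knot as a
`KnotIsotopyInBoundary`), `isFramingAlong_ambient` (its differentials carry a framing,
`IsKnotFraming.pushforward` + `continuous_mfderiv_ambientIsotopy_bundle`), `framingHomotopic_ambient_end`,
`exists_margin` (uniform positive lower bound for finitely many positive continuous functions on the
circle).  A self-contained copy of this design file with §0 spelled out is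
`work/stubs/scratchY3/T3c2_SeamTransport_Design_v1_selfcontained.lean` (rc 0, 1 sorry). -/

/-! ## §1 The sub-nodes ST1–ST4 -/

section SubNodes

variable (g : ℕ)

/-- The page clause of `ModelsOnFibred` for the data `(h, D, bX, Ψ)`: `Ψ` preserves page angles on the
base part of the seam (VERBATIM copy of `PageClause` of `T3_DualHandles_Design.lean`; delete one copy
when merging the two design files). [cite: EtnyreFuller2006, Thm. 1 (proof, p. 8)] -/
def PageClause {l : List ((Fin g ⊕ Fin g → ℤ) × Bool)} {X : Type} [TopologicalSpace X]
    [ChartedSpace (EuclideanHalfSpace 4) X] (h : Fin l.length → HandleAttachingMap 3 2 (Base g))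
    (D : MultiAttachmentData h (𝓡∂ 4) X) (bX : BoundaryData (𝓡∂ 4) X (𝓡 3))
    (Ψ : bX.carrier ≃ₘ⟮𝓡 3, 𝓡 3⟯ (bBase g).carrier) : Prop :=
  ∀ (y : bX.carrier) (a : ↥(coresComplement h)), bX.incl y = D.jA a →
    ∃ c : ℝ, 0 < c ∧ w g ((bBase g).incl (Ψ y)).1 = (c : ℂ) * w g (a : Base g).1

/-- **SUB-NODE ST2 (`node_ST2_straightening`) — the radial straightening isotopy of the base.
LANDED**: this is `helper_strFlow_page` of `…SeamStraightenFlow.lean` VERBATIM (flow of the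
straightening field `strField g (1/m²)` of `…SeamStraightenField.lean`, `helper_strField_spec`
p148974): an ambient isotopy `R` of `Base g`, restriction of a smooth flow `θ` of `ℝ⁴`, preserving
`rho`, the direction of `w` (`w (θ_t x) = r w x`, `r > 0`), not decreasing `‖w‖` nor increasing
`‖x‖²` forwards, fixing the binding and `{‖x‖² ≤ 3}`, FLATTENING at time `1` (`rho ≤ 3/10`,
`‖w‖ ≥ m ⇒ ‖x (θ_1 x)‖² < 4`), mapping flat pages into themselves forwards and every point of the
extended page `{rho = 1/4, w ∈ ℝ_{>0} c}` with `‖w‖ ≥ m` into `page g c` at time `1`.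
[cite: Baykur2006, Thm. 5.1 (proof, p. 13)] -/
theorem node_ST2_straightening : ∀ (g : ℕ) (m : ℝ), 0 < m → ∃ (R : Literature.Topology.FourManifolds.AmbientIsotopy (𝓡∂ 4) (Literature.Topology.FourManifolds.LefschetzBase.Base g)) (θ : ℝ × EuclideanSpace ℝ (Fin 4) → EuclideanSpace ℝ (Fin 4)), ContDiff ℝ ∞ θ ∧ (∀ x, θ (0, x) = x) ∧ (∀ t s x, θ (t, θ (s, x)) = θ (t + s, x)) ∧ (∀ (t : ℝ) (x : Literature.Topology.FourManifolds.LefschetzBase.Base g), (R.toFun t x).1 = θ (t, x.1)) ∧ (∀ t x, Literature.Topology.FourManifolds.LefschetzBase.rho g (θ (t, x)) = Literature.Topology.FourManifolds.LefschetzBase.rho g x) ∧ (∀ t x, ∃ r : ℝ, 0 < r ∧ Literature.Topology.FourManifolds.LefschetzBase.w g (θ (t, x)) = (r : ℂ) * Literature.Topology.FourManifolds.LefschetzBase.w g x) ∧ (∀ t x, 0 ≤ t → ‖Literature.Topology.FourManifolds.LefschetzBase.w g x‖ ≤ ‖Literature.Topology.FourManifolds.LefschetzBase.w g (θ (t, x))‖)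 ∧ (∀ t x, 0 ≤ t → ‖Literature.Topology.FourManifolds.LefschetzBase.cx (θ (t, x))‖ ^ 2 ≤ ‖Literature.Topology.FourManifolds.LefschetzBase.cx x‖ ^ 2) ∧ (∀ x, Literature.Topology.FourManifolds.LefschetzBase.w g x = 0 → ∀ t, θ (t, x) = x) ∧ (∀ x, ‖Literature.Topology.FourManifolds.LefschetzBase.cx x‖ ^ 2 ≤ 3 → ∀ t, θ (t, x) = x) ∧ (∀ x, Literature.Topology.FourManifolds.LefschetzBase.rho g x ≤ 3 / 10 → m ≤ ‖Literature.Topology.FourManifolds.LefschetzBase.w g x‖ → ‖Literature.Topology.FourManifolds.LefschetzBase.cx (θ (1, x))‖ ^ 2 < 4) ∧ (∀ (t : ℝ) (x : Literature.Topology.FourManifolds.LefschetzBase.Base g) (c : ℂ), 0 ≤ t → x ∈ Literature.Topology.FourManifolds.LefschetzBase.page g c → R.toFun t x ∈ Literature.Topology.FourManifolds.LefschetzBase.page g c) ∧ (∀ (x : Literature.Topology.FourManifolds.LefschetzBase.Base g) (c : ℂ), ‖c‖ = 1 → Literature.Topology.FourManifolds.LefschetzBase.rho g x.1 = 1 / 4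 → m ≤ ‖Literature.Topology.FourManifolds.LefschetzBase.w g x.1‖ → (∃ r : ℝ, 0 < r ∧ Literature.Topology.FourManifolds.LefschetzBase.w g x.1 = (r : ℂ) * c) → R.toFun 1 x ∈ Literature.Topology.FourManifolds.LefschetzBase.page g c) :=
  helper_strFlow_page

variable (l : List ((Fin g ⊕ Fin g → ℤ) × Bool))
  (h : Fin l.length → HandleAttachingMap 3 2 (Base g)) (hlink : IsLefschetzLink g l h)
  {X : Type} [TopologicalSpace X] [T2Space X] [SecondCountableTopology X] [CompactSpace X]
  [ChartedSpace (EuclideanHalfSpace 4) X] [IsManifold (𝓡∂ 4) ∞ X]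
  (D : MultiAttachmentData h (𝓡∂ 4) X) (bX : BoundaryData (𝓡∂ 4) X (𝓡 3))
  (Ψ : bX.carrier ≃ₘ⟮𝓡 3, 𝓡 3⟯ (bBase g).carrier) (hpage : PageClause g h D bX Ψ)

include hlink hpage

omit hlink [SecondCountableTopology X] [CompactSpace X] in
/-- **SUB-NODE ST1 (`node_ST1_extendedPage`) — the pushed framed knot lies in the extended page.**
For a framed page knot `(K ⊂ page g c, ν)` off the cores with lifts `z` (points) and `u` (framing
vectors) through `bX.incl`, the pushed knot `θ ↦ (bBase g).incl (Ψ (z θ))` is a knot in `∂ Base g`,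
the pushed vectors `d((bBase g).incl ∘ Ψ)_{z θ} (u θ)` are a framing of it, it lies in `{rho = 1/4}`
and in the extended page of direction `c`: `w = r · c`, `r > 0` (page clause at `a = K θ`:
`w = c' · w (K θ) = c' c / 2`).  LANDED (`seam_extendedPage` / registered `helper_seam_extendedPage`,
`…SeamExtendedPage.lean`, 186 lines): the lifts are forced — `bX.incl` is
injective, so `z θ = R ⟨D.jA ⟨K θ, _⟩, _⟩` for the restriction `R` of the identity
(`incl_restrict_refl`), and `d(bX.incl)` is injective (immersion), so `u θ = dR (tail (d jA ν))`
(`mfderiv_incl_tail`); then `isBoundaryKnot_jA_comp`, `isKnotFraming_jA_push` (Z5),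
`helper_isKnotFraming_seamPush` (Z7 A) for `seamDiffeo bX (bBase g) Ψ`, read back through
`coe_seamDiffeo` / `helper_mfderiv_seamDiffeo` (Z7 G). [cite: Kosinski1993, VI §6] -/
theorem node_ST1_extendedPage (c : ℂ) (hc : ‖c‖ = 1)
    (K : sphere (0 : EuclideanSpace ℝ (Fin 2)) 1 → Base g)
    (ν : sphere (0 : EuclideanSpace ℝ (Fin 2)) 1 → EuclideanSpace ℝ (Fin 4))
    (hKc : Continuous K) (hK : ∀ θ, K θ ∈ coresComplement h) (hKp : ∀ θ, K θ ∈ page g c)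
    (hKb : IsBoundaryKnot K) (hKν : IsKnotFraming K ν)
    (z : sphere (0 : EuclideanSpace ℝ (Fin 2)) 1 → bX.carrier)
    (hz : ∀ θ, bX.incl (z θ) = D.jA ⟨K θ, hK θ⟩)
    (u : sphere (0 : EuclideanSpace ℝ (Fin 2)) 1 → EuclideanSpace ℝ (Fin 3))
    (hu : ∀ θ, mfderiv (𝓡 3) (𝓡∂ 4) bX.incl (z θ) (u θ) =
      mfderiv (𝓡∂ 4) (𝓡∂ 4) (fun a : ↥(coresComplement h) => D.jA a) ⟨K θ, hK θ⟩ (ν θ)) :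
    IsBoundaryKnot (fun θ => ((bBase g).incl (Ψ (z θ)) : Base g)) ∧
    IsKnotFraming (fun θ => ((bBase g).incl (Ψ (z θ)) : Base g))
      (fun θ => mfderiv (𝓡 3) (𝓡∂ 4) (fun y => ((bBase g).incl (Ψ y) : Base g)) (z θ) (u θ)) ∧
    (∀ θ, rho g ((bBase g).incl (Ψ (z θ)) : Base g).1 = 1 / 4) ∧
    (∀ θ, ∃ r : ℝ, 0 < r ∧ w g ((bBase g).incl (Ψ (z θ)) : Base g).1 = (r : ℂ) * c) :=
  seam_extendedPage D bX Ψ hpage c K ν hK hKp hKb hKν z hz u hu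

/-- **SUB-NODE ST3 (`node_ST3_shadowTransport`) — the shadow of the pushed knot is the shadow of the
knot pushed through ONE automorphism `A_c` of `ℤ^{2g}` depending on `(Ψ, c)` only** (uniform over all
page knots of direction `c` off the cores; stronger than the node, which lets `A` depend on the knot).
LANDED/PROPOSED as `seam_shadowTransport` / registered `helper_seam_shadowTransport`
(`…SeamShadowTransport.lean`, on top of `…SeamFibreMap.lean` (ST3-core), `…SeamShadowLinear.lean`
(ST3a), `…SeamShadowInverse.lean` (ST3b); ≈ 920 lines in all).  Route, see the file header: `F := G ∘ lift` is an angle-preserving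
diffeomorphism `∂B ∖ cores ≅ ∂B ∖ β`; for non-critical `c` its fibre map `F_c : E_c → E_c` is a
homeomorphism and `A_c := e ∘ (F_c)_* ∘ e⁻¹` on `H₁(page g c) ≅ H₁(Base g) ≅ ℤ^{2g}` (Z6-2:
`bijective_shadowMap_map_pageIncl`, `loopClass_page_eq_of_shadow_eq`, `exists_pageLoop_shadow_eq`;
naturality `map_loopClass`; `F_c`-images straightened back into `page g c` inside `E_c` by ST2 and
`shadow_comp_ambientIsotopy`; `β ∩ E_c = ∅` by `helper_belt_pageClause` and continuity; the inverse
matrix from `F⁻¹`); for a critical `c`, `A_c := A_{c e^{iε}}` by the rigid page rotation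
`helper_rotFlow_page` off the finitely many critical pages (`shadow_eq_of_family`).
[cite: Baykur2006, Thm. 5.1 (proof, p. 13)] -/
theorem node_ST3_shadowTransport (c : ℂ) (hc : ‖c‖ = 1) :
    ∃ A : (Fin g ⊕ Fin g → ℤ) ≃ₗ[ℤ] (Fin g ⊕ Fin g → ℤ),
      ∀ (K : sphere (0 : EuclideanSpace ℝ (Fin 2)) 1 → Base g) (hKc : Continuous K)
        (hK : ∀ θ, K θ ∈ coresComplement h) (_ : ∀ θ, K θ ∈ page g c)
        (z : sphere (0 : EuclideanSpace ℝ (Fin 2)) 1 → bX.carrier)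
        (_ : ∀ θ, bX.incl (z θ) = D.jA ⟨K θ, hK θ⟩)
        (hGz : Continuous fun θ => ((bBase g).incl (Ψ (z θ)) : Base g)),
        shadow g (fun θ => ((bBase g).incl (Ψ (z θ)) : Base g)) hGz = A (shadow g K hKc) :=
  seam_shadowTransport D bX Ψ hlink hpage hc

/-- **SUB-NODE ST4 (`node_ST4_twistSign`) — the global twisting sign.**  There is `s₀ = ±1` (the
orientation character of the angle-preserving seam map `F = (bBase g).incl ∘ Ψ ∘ lift` on
`∂ Base g ∖ cores`) such that for every framed page knot `(K ⊂ page g c, ν)` off the cores, lifts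
`z, u`, and EVERY fibred ambient isotopy `R` of `Base g` (preserving `rho` and the direction of `w`
at all times) whose time-`1` map flattens the pushed knot into `page g c`, the straightened pushed
framed knot `(R_1 ∘ G ∘ z, dR_1 dG u)` has page twisting `s₀ · pageTwisting K ν`.  Proof route
(L, ≈ 700–900 lines), see the file header: pointwise `ℓ̃₂ = p ℓ₂` (`p > 0`, angle preservation) and
`ℓ₂ = 0 ⇒ ℓ̃₁ = det (dΓ|T page) ℓ₁` for `Γ = R_1 ∘ F` (template: V3's
`pageTwistingLoop_baseReflection_pointwise`, `helper_twistPair_eq_zero_iff`, `fderiv_rho_ambient`),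
straight-line homotopy through invertible upper-triangular matrix fields = the LANDED
`helper_wind_upperTriangular` (`wind (b ℓ₁ + β ℓ₂, b' ℓ₂) = σ wind ℓ` for `σ b > 0`, `b' > 0`); the sign of
`det (dΓ|T page)` is the orientation character of `F` (that of `R_1` is `+1` by continuity in `t`),
constant along the knot and GLOBALLY constant by connectedness of the sectors of `∂B ∖ cores`
(ST2 + `pathConnectedSpace_page_of_norm` + `helper_rotFlow_page` + `frequently_neg_ray`).
[cite: EtnyreFuller2006, Thm. 1 (proof, p. 8)] -/
theorem node_ST4_twistSign :
    ∃ s₀ : ℤ, (s₀ = 1 ∨ s₀ = -1) ∧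
      ∀ (c : ℂ) (_ : ‖c‖ = 1) (K : sphere (0 : EuclideanSpace ℝ (Fin 2)) 1 → Base g)
        (ν : sphere (0 : EuclideanSpace ℝ (Fin 2)) 1 → EuclideanSpace ℝ (Fin 4))
        (hK : ∀ θ, K θ ∈ coresComplement h) (_ : ∀ θ, K θ ∈ page g c)
        (_ : IsBoundaryKnot K) (_ : IsKnotFraming K ν)
        (z : sphere (0 : EuclideanSpace ℝ (Fin 2)) 1 → bX.carrier)
        (_ : ∀ θ, bX.incl (z θ) = D.jA ⟨K θ, hK θ⟩)
        (u : sphere (0 : EuclideanSpace ℝ (Fin 2)) 1 → EuclideanSpace ℝ (Fin 3))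
        (_ : ∀ θ, mfderiv (𝓡 3) (𝓡∂ 4) bX.incl (z θ) (u θ) =
          mfderiv (𝓡∂ 4) (𝓡∂ 4) (fun a : ↥(coresComplement h) => D.jA a) ⟨K θ, hK θ⟩ (ν θ))
        (R : AmbientIsotopy (𝓡∂ 4) (Base g))
        (_ : ∀ (t : ℝ) (x : Base g), rho g (R.toFun t x).1 = rho g x.1)
        (_ : ∀ (t : ℝ) (x : Base g), ∃ r : ℝ, 0 < r ∧ w g (R.toFun t x).1 = (r : ℂ) * w g x.1)
        (_ : ∀ θ, R.toFun 1 ((bBase g).incl (Ψ (z θ))) ∈ page g c),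
        pageTwisting g (R.toFun 1 ∘ fun θ => ((bBase g).incl (Ψ (z θ)) : Base g))
            (fun θ => mfderiv (𝓡∂ 4) (𝓡∂ 4) (R.toFun 1) ((bBase g).incl (Ψ (z θ)))
              (mfderiv (𝓡 3) (𝓡∂ 4) (fun y => ((bBase g).incl (Ψ y) : Base g)) (z θ) (u θ))) =
          s₀ * pageTwisting g K ν := by
  sorry

end SubNodes

/-! ## §2 SUB-NODE ST5: the node text, assembled from ST1–ST4 (PROVED) -/

section Assembly

variable (g : ℕ)

/-- **NODE T3c-2 (`node_seam_transport`) — the page clause transports framed page knots** — the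
text of `T3_DualHandles_Design.lean` l. 544–575 VERBATIM, PROVED from the sub-nodes ST1–ST4
(ST2 landed): the sign `s₀` is ST4's; for a family `(K i ⊂ page (c i), ν i)` at distinct directions
with lifts `z i, u i`: ST1 makes the pushed framed knots `(G ∘ z i, dG (u i))` framed knots of
`∂ Base g` in the extended pages `E_{c i}` with `‖w‖ ≥ m > 0` (`exists_margin`); ST2 at margin `m`
gives the straightening isotopy `R`; `K' i := R_1 ∘ G ∘ z i ⊆ page g (c i)`, `ν' i := dR_1 (dG (u i))`,
`νt i t := dR_t (dG (u i))`, `Φ` := the ambient isotopy applied to the pushed link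
(`knotIsotopyOfAmbient`; components disjoint since `R_t`, `G`, the lift and `jA` are injective and the
`K i` lie in pairwise disjoint pages), `IsFramingAlong` by `isFramingAlong_ambient`, the end homotopy
is `FramingHomotopic.refl`; shadows: `shadow_comp_ambientIsotopy` + ST3 (`A i := A_{c i}`); twisting:
ST4. [cite: Baykur2006, Thm. 5.1 (proof, p. 13); EtnyreFuller2006, Thm. 1 (proof, p. 8)] -/
theorem node_seam_transport (l : List ((Fin g ⊕ Fin g → ℤ) × Bool))
    (h : Fin l.length → HandleAttachingMap 3 2 (Base g)) (hlink : IsLefschetzLink g l h)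
    {X : Type} [TopologicalSpace X] [T2Space X] [SecondCountableTopology X] [CompactSpace X]
    [ChartedSpace (EuclideanHalfSpace 4) X] [IsManifold (𝓡∂ 4) ∞ X]
    (D : MultiAttachmentData h (𝓡∂ 4) X) (bX : BoundaryData (𝓡∂ 4) X (𝓡 3))
    (Ψ : bX.carrier ≃ₘ⟮𝓡 3, 𝓡 3⟯ (bBase g).carrier) (hpage : PageClause g h D bX Ψ) :
    ∃ s₀ : ℤ, (s₀ = 1 ∨ s₀ = -1) ∧
      ∀ (ι : Type) [Finite ι] (c : ι → ℂ) (_ : ∀ i, ‖c i‖ = 1) (_ : Injective c)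
        (K : ι → sphere (0 : EuclideanSpace ℝ (Fin 2)) 1 → Base g)
        (ν : ι → sphere (0 : EuclideanSpace ℝ (Fin 2)) 1 → EuclideanSpace ℝ (Fin 4))
        (hKc : ∀ i, Continuous (K i)) (hK : ∀ i θ, K i θ ∈ coresComplement h)
        (_ : ∀ i θ, K i θ ∈ page g (c i)) (_ : ∀ i, IsBoundaryKnot (K i))
        (_ : ∀ i, IsKnotFraming (K i) (ν i))
        (z : ι → sphere (0 : EuclideanSpace ℝ (Fin 2)) 1 → bX.carrier)
        (_ : ∀ i θ, bX.incl (z i θ) = D.jA ⟨K i θ, hK i θ⟩)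
        (u : ι → sphere (0 : EuclideanSpace ℝ (Fin 2)) 1 → EuclideanSpace ℝ (Fin 3))
        (_ : ∀ i θ, mfderiv (𝓡 3) (𝓡∂ 4) bX.incl (z i θ) (u i θ) =
          mfderiv (𝓡∂ 4) (𝓡∂ 4) (fun a : ↥(coresComplement h) => D.jA a) ⟨K i θ, hK i θ⟩ (ν i θ)),
        ∃ (A : ι → ((Fin g ⊕ Fin g → ℤ) ≃ₗ[ℤ] (Fin g ⊕ Fin g → ℤ)))
          (K' : ι → sphere (0 : EuclideanSpace ℝ (Fin 2)) 1 → Base g)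
          (ν' : ι → sphere (0 : EuclideanSpace ℝ (Fin 2)) 1 → EuclideanSpace ℝ (Fin 4))
          (hK'c : ∀ i, Continuous (K' i))
          (Φ : LinkIsotopyInBoundary (fun i θ => ((bBase g).incl (Ψ (z i θ)) : Base g)) K')
          (νt : ι → ℝ → sphere (0 : EuclideanSpace ℝ (Fin 2)) 1 → EuclideanSpace ℝ (Fin 4)),
          (∀ i θ, K' i θ ∈ page g (c i)) ∧ (∀ i, IsKnotFraming (K' i) (ν' i)) ∧
          (∀ i, shadow g (K' i) (hK'c i) = A i (shadow g (K i) (hKc i))) ∧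
          (∀ i, pageTwisting g (K' i) (ν' i) = s₀ * pageTwisting g (K i) (ν i)) ∧
          (∀ i, IsFramingAlong (Φ.isotopy i)
            (fun θ => mfderiv (𝓡 3) (𝓡∂ 4) (fun y => ((bBase g).incl (Ψ y) : Base g)) (z i θ) (u i θ))
            (νt i)) ∧
          (∀ i, FramingHomotopic (K' i) (νt i 1) (ν' i)) := by
  obtain ⟨s₀, hs₀, hST4⟩ := node_ST4_twistSign g l h hlink D bX Ψ hpage
  refine ⟨s₀, hs₀, ?_⟩
  intro ι _ c hc hcinj K ν hKc hK hKp hKb hKν z hz u hu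
  -- ST1: the pushed framed knots are framed knots of `∂ Base g` in the extended pages
  have hST1 := fun i => node_ST1_extendedPage g l h D bX Ψ hpage (c i) (hc i) (K i) (ν i)
    (hKc i) (hK i) (hKp i) (hKb i) (hKν i) (z i) (hz i) (u i) (hu i)
  have hkb : ∀ i, IsBoundaryKnot (fun θ => ((bBase g).incl (Ψ (z i θ)) : Base g)) := fun i => (hST1 i).1
  have hkμ : ∀ i, IsKnotFraming (fun θ => ((bBase g).incl (Ψ (z i θ)) : Base g))
      (fun θ => mfderiv (𝓡 3) (𝓡∂ 4) (fun y => ((bBase g).incl (Ψ y) : Base g)) (z i θ) (u i θ)) :=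
    fun i => (hST1 i).2.1
  have hkρ : ∀ i θ, rho g ((bBase g).incl (Ψ (z i θ)) : Base g).1 = 1 / 4 := fun i => (hST1 i).2.2.1
  have hkw : ∀ i θ, ∃ r : ℝ, 0 < r ∧ w g ((bBase g).incl (Ψ (z i θ)) : Base g).1 = (r : ℂ) * c i :=
    fun i => (hST1 i).2.2.2
  have hkc : ∀ i, Continuous (fun θ => ((bBase g).incl (Ψ (z i θ)) : Base g)) := fun i =>
    (hkb i).isSmoothEmbedding.contMDiff.continuous
  -- the margin `m`: `‖w‖ ≥ m` on all pushed knots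
  obtain ⟨m, hm0, hmw⟩ : ∃ m : ℝ, 0 < m ∧ ∀ i θ, m ≤ ‖w g ((bBase g).incl (Ψ (z i θ)) : Base g).1‖ := by
    refine exists_margin (fun i θ => ‖w g ((bBase g).incl (Ψ (z i θ)) : Base g).1‖) (fun i => ?_)
      (fun i θ => ?_)
    · exact ((contDiff_w g).continuous.comp (continuous_subtype_val.comp (hkc i))).norm
    · obtain ⟨r, hr, hrw⟩ := hkw i θ
      show 0 < ‖w g ((bBase g).incl (Ψ (z i θ)) : Base g).1‖
      rw [hrw, norm_mul, Complex.norm_real, Real.norm_eq_abs, abs_of_pos hr, hc i, mul_one]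
      exact hr
  -- ST2: the straightening isotopy at margin `m`
  obtain ⟨R, θf, -, -, -, hRθ, hρθ, hdirθ, -, -, -, -, -, -, hflat⟩ := node_ST2_straightening g m hm0
  have hRρ : ∀ (t : ℝ) (x : Base g), rho g (R.toFun t x).1 = rho g x.1 := fun t x => by
    rw [hRθ, hρθ]
  have hRdir : ∀ (t : ℝ) (x : Base g), ∃ r : ℝ, 0 < r ∧ w g (R.toFun t x).1 = (r : ℂ) * w g x.1 :=
    fun t x => by rw [hRθ]; exact hdirθ t x.1
  have hK'p : ∀ i θ, R.toFun 1 ((bBase g).incl (Ψ (z i θ))) ∈ page g (c i) := fun i θ =>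
    hflat _ (c i) (hc i) (hkρ i θ) (hmw i θ) (hkw i θ)
  -- ST3: the automorphisms `A i := A_{c i}`
  have hA3 := fun i => node_ST3_shadowTransport g l h hlink D bX Ψ hpage (c i) (hc i)
  choose A hA using hA3
  -- the link isotopy: components stay pairwise disjoint
  have hdisj : ∀ t : ℝ, Pairwise fun i j =>
      Disjoint (range (R.toFun t ∘ fun θ => ((bBase g).incl (Ψ (z i θ)) : Base g)))
        (range (R.toFun t ∘ fun θ => ((bBase g).incl (Ψ (z j θ)) : Base g))) := by
    intro t i j hij
    rw [Set.disjoint_left]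
    rintro x ⟨θ, rfl⟩ ⟨θ', hθ'⟩
    have h1 : ((bBase g).incl (Ψ (z j θ')) : Base g) = (bBase g).incl (Ψ (z i θ)) :=
      (R.bijective t).1 hθ'
    have h2 : z j θ' = z i θ := Ψ.injective ((bBase g).injective_incl h1)
    have h3 : D.jA ⟨K j θ', hK j θ'⟩ = D.jA ⟨K i θ, hK i θ⟩ := by rw [← hz, ← hz, h2]
    have h4 : K j θ' = K i θ := congrArg Subtype.val (D.hjA.isEmbedding.injective h3)
    have h5 : K i θ ∈ page g (c j) := h4 ▸ hKp j θ'
    by_cases hcc : c i = c j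
    · exact hij (hcinj hcc)
    · exact Set.disjoint_left.1 (disjoint_page g hcc) (hKp i θ) h5
  -- the outputs
  refine ⟨A, fun i => R.toFun 1 ∘ fun θ => ((bBase g).incl (Ψ (z i θ)) : Base g),
    fun i θ => mfderiv (𝓡∂ 4) (𝓡∂ 4) (R.toFun 1) ((bBase g).incl (Ψ (z i θ)))
      (mfderiv (𝓡 3) (𝓡∂ 4) (fun y => ((bBase g).incl (Ψ y) : Base g)) (z i θ) (u i θ)),
    fun i => (R.contMDiff_toFun 1).continuous.comp (hkc i),
    ⟨fun i => knotIsotopyOfAmbient R hRρ (hkb i), fun t _ => hdisj t⟩,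
    fun i t θ => mfderiv (𝓡∂ 4) (𝓡∂ 4) (R.toFun t) ((bBase g).incl (Ψ (z i θ)))
      (mfderiv (𝓡 3) (𝓡∂ 4) (fun y => ((bBase g).incl (Ψ y) : Base g)) (z i θ) (u i θ)),
    fun i θ => hK'p i θ, fun i => (hkμ i).pushforward (hkb i) (R.toDiffeomorph 1), fun i => ?_,
    fun i => ?_, fun i => isFramingAlong_ambient R hRρ (hkb i) (hkμ i),
    fun i => framingHomotopic_ambient_end R (hkb i) (hkμ i)⟩
  · -- shadows: invariance along the ambient isotopy, then ST3
    rw [shadow_comp_ambientIsotopy R 1 (hkc i)]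
    exact hA i (K i) (hKc i) (hK i) (hKp i) (z i) (hz i) (hkc i)
  · -- twisting: ST4
    exact hST4 (c i) (hc i) (K i) (ν i) (hK i) (hKp i) (hKb i) (hKν i) (z i) (hz i) (u i) (hu i) R
      hRρ hRdir (hK'p i)


/-- **The node in contract form**: the same statement obtained by ONE application of the landed
contract `node_seam_transport_of_twistSign` (`…SeamTransportAssembly.lean`, p152668) to the remaining
sub-node ST4 — this is how the lead closes `node_seam_transport` once `node_ST4_twistSign` is proved.
[cite: Baykur2006, Thm. 5.1 (proof, p. 13)] -/
theorem node_seam_transport_via_contract (l : List ((Fin g ⊕ Fin g → ℤ) × Bool))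
    (h : Fin l.length → HandleAttachingMap 3 2 (Base g)) (hlink : IsLefschetzLink g l h)
    {X : Type} [TopologicalSpace X] [T2Space X] [SecondCountableTopology X] [CompactSpace X]
    [ChartedSpace (EuclideanHalfSpace 4) X] [IsManifold (𝓡∂ 4) ∞ X]
    (D : MultiAttachmentData h (𝓡∂ 4) X) (bX : BoundaryData (𝓡∂ 4) X (𝓡 3))
    (Ψ : bX.carrier ≃ₘ⟮𝓡 3, 𝓡 3⟯ (bBase g).carrier) (hpage : PageClause g h D bX Ψ) :
    ∃ s₀ : ℤ, (s₀ = 1 ∨ s₀ = -1) ∧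
      ∀ (ι : Type) [Finite ι] (c : ι → ℂ) (_ : ∀ i, ‖c i‖ = 1) (_ : Injective c)
        (K : ι → sphere (0 : EuclideanSpace ℝ (Fin 2)) 1 → Base g)
        (ν : ι → sphere (0 : EuclideanSpace ℝ (Fin 2)) 1 → EuclideanSpace ℝ (Fin 4))
        (hKc : ∀ i, Continuous (K i)) (hK : ∀ i θ, K i θ ∈ coresComplement h)
        (_ : ∀ i θ, K i θ ∈ page g (c i)) (_ : ∀ i, IsBoundaryKnot (K i))
        (_ : ∀ i, IsKnotFraming (K i) (ν i))
        (z : ι → sphere (0 : EuclideanSpace ℝ (Fin 2)) 1 → bX.carrier)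
        (_ : ∀ i θ, bX.incl (z i θ) = D.jA ⟨K i θ, hK i θ⟩)
        (u : ι → sphere (0 : EuclideanSpace ℝ (Fin 2)) 1 → EuclideanSpace ℝ (Fin 3))
        (_ : ∀ i θ, mfderiv (𝓡 3) (𝓡∂ 4) bX.incl (z i θ) (u i θ) =
          mfderiv (𝓡∂ 4) (𝓡∂ 4) (fun a : ↥(coresComplement h) => D.jA a) ⟨K i θ, hK i θ⟩ (ν i θ)),
        ∃ (A : ι → ((Fin g ⊕ Fin g → ℤ) ≃ₗ[ℤ] (Fin g ⊕ Fin g → ℤ)))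
          (K' : ι → sphere (0 : EuclideanSpace ℝ (Fin 2)) 1 → Base g)
          (ν' : ι → sphere (0 : EuclideanSpace ℝ (Fin 2)) 1 → EuclideanSpace ℝ (Fin 4))
          (hK'c : ∀ i, Continuous (K' i))
          (Φ : LinkIsotopyInBoundary (fun i θ => ((bBase g).incl (Ψ (z i θ)) : Base g)) K')
          (νt : ι → ℝ → sphere (0 : EuclideanSpace ℝ (Fin 2)) 1 → EuclideanSpace ℝ (Fin 4)),
          (∀ i θ, K' i θ ∈ page g (c i)) ∧ (∀ i, IsKnotFraming (K' i) (ν' i)) ∧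
          (∀ i, shadow g (K' i) (hK'c i) = A i (shadow g (K i) (hKc i))) ∧
          (∀ i, pageTwisting g (K' i) (ν' i) = s₀ * pageTwisting g (K i) (ν i)) ∧
          (∀ i, IsFramingAlong (Φ.isotopy i)
            (fun θ => mfderiv (𝓡 3) (𝓡∂ 4) (fun y => ((bBase g).incl (Ψ y) : Base g)) (z i θ) (u i θ))
            (νt i)) ∧
          (∀ i, FramingHomotopic (K' i) (νt i 1) (ν' i)) :=
  node_seam_transport_of_twistSign D bX Ψ hlink hpage (node_ST4_twistSign g l h hlink D bX Ψ hpage)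

end Assembly

end Summit.SmoothPoincare4.SmoothPoincare4.Theorems.AcyclicBisectionExists.ModpBraidOrbits

end
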